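import Mathlib
import HarnessLib
import Summits.NavierStokesRegularity.NavierStokesRegularity.Theorems.HalfSpaceWindowDoorCirculationCarryingRigidityEddyTorqueStrata

/-!
# Route `HalfSpaceWindowDoor`, crux `CirculationCarryingRigidity` (stmt-NavierStokesRegularity-25311) — WHAT THE REMAINDER IS:
# `ℛ = −∮ (v'·∇)(r v_θ) dθ`, the circle-integrated advection of angular-momentum density by the velocity FLUCTUATION

Line `eddy_torque` (LEAD ns-hsw-p1 g4), companion of the census theorem `…EddyTorqueLiouville` (closed-hemisphere
axis-Type-I profiles with `|ℛ| ≤ A/(r+√(−s))·∮ω₃ dl` are poloidal).  This file certifies the physical meaning of the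
hypothesis.  With `g = x₀v₁ − x₁v₀ = r v_θ` (KNSS's swirl, the angular-momentum density about the apex axis):

* `circleTerm_eq_integral_fderiv_swirl`: LRT's circle term IS the circle-integrated advection of `g`,
  `T = ∮(v_r ω₃ − ω_r v₃) dl = ∫₀^{2π} Dg(y)[v(y)] dθ` (the `e_θ`-component of the Lamb form — AxisTwistDoor's
  `convective_pointwise` — plus `∮∂_θ|v|²/2 = 0`);
* `integral_fderiv_swirl_eRang / _smul_eT / _e3`: the frame integrals `∮Dg[e_r] = ∮ω₃ dl`, `∮Dg[r e_θ] = 0`,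
  `∮Dg[e₃] = −∮ω_r dl` (Stokes on circles, periodicity);
* `integral_fderiv_swirl_angularMeanVec`: the ANGULAR-MEAN drift advects `g` exactly by the mean terms of the circle law,
  `∫₀^{2π} Dg[⟨v⟩_θ] dθ = v̄_r ∮ω₃ dl − v̄_z ∮ω_r dl` (frame expansion of `⟨v⟩_θ` on the circle: components `v̄_r`, an
  angle-independent `⟨v_θ⟩_θ`, `v̄_z`);
* `remainder_eq_neg_integral_fderiv_swirl_angularFluctVec`: **`ℛ = −∫₀^{2π} Dg(y)[v'(y)] dθ`**, `v' = v − ⟨v⟩_θ`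
  (Pineau–Vicol `angularFluctVec`): the fluctuation remainder of the circle-averaged swirl law is minus the EDDY TORQUE — the
  circle-integrated advection of angular momentum by the non-axisymmetric part of the velocity.  (As `div v' = 0` and
  `∮(v'·∇)⟨g⟩_θ dθ = 0`, this is the divergence form `−[(1/r)∂ᵣ(r²∮v'_r v'_θ dθ) + ∂_z(r∮v'_z v'_θ dθ)]` of the eddy
  angular-momentum flux; that last rewriting is not needed by the line and is not formalised here.)

So the census theorem reads: in the axis-Type-I subclass a circulation-carrying closed-hemisphere profile must have, on some
axis circles, eddy advection of angular momentum NOT controlled by `D/(r+√(−s))` times the mean vertical vorticity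
`∮ω₃ dl` — all mean-flow (m = 0) transport being harmless.

Seat ns-hsw-p1 g4 (LEAD of 25311, cell pub-ns-dss).  WHAT THIS IS NOT: not a statement about Navier–Stokes regularity
(Clay A): circle calculus for HYPOTHETICAL blow-up profiles; helper `--supports` 25311; nothing is closed here.
-/

noncomputable section

-- the summit and its single sub-problem share the name (CONVENTIONS §1), as in every Theorems file
set_option linter.dupNamespace false

namespace Summit.NavierStokesRegularity.NavierStokesRegularity.Theorems.HalfSpaceWindowDoorCirculationCarryingRigidityEddyTorqueIdentity

open MeasureTheory Set Function Filter Topology TopologicalSpace InnerProductSpace WithLp Metric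
open scoped RealInnerProductSpace ContDiff Classical
open Literature.Analysis Literature.Analysis.FluidPDE
open Summit.NavierStokesRegularity.NavierStokesRegularity.Theorems.AxisTwistDoorAveragedConeLiouvilleDefs
  (cylPt eT e3 circ vortCirc radVortCirc circleTerm meanR meanZ remainder)
open Summit.NavierStokesRegularity.NavierStokesRegularity.Theorems.AveragedConeLiouville.CircleStokes
  (continuous_eR continuous_eT inner_e3 cylPt_two_pi key_identity integral_theta_deriv_eq_zero continuous_radial_theta_deriv
    hasDerivAt_cylPt_theta)
open Summit.NavierStokesRegularity.NavierStokesRegularity.Theorems.AveragedConeLiouville.CircleCalculus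
  (convective_pointwise integral_kinetic_eq_zero)
open Summit.NavierStokesRegularity.NavierStokesRegularity.Theorems.AveragedConeLiouville.CircleSwirl (circleTerm_eq)
open Summit.NavierStokesRegularity.NavierStokesRegularity.Theorems.AveragedConeLiouville.ShellBookkeeping (cylRadius_cylPt)
open Summit.NavierStokesRegularity.NavierStokesRegularity.Theorems.AxisTwistDoorAveragedConeLiouvilleCylFrame
  (inner_eR inner_eT continuous_cylPt_θ inner_curl_eR_mul integral_fderiv_tangent_apply_two)
open Summit.NavierStokesRegularity.NavierStokesRegularity.Theorems.HalfSpaceWindowDoorCirculationCarryingRigidityAxisCirculation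
  (rotZ_cylPt)
open Summit.NavierStokesRegularity.NavierStokesRegularity.Theorems.HalfSpaceWindowDoorCirculationCarryingRigidityAngularMeanDrift
  (eR_cylPt angularMean_radialVelocity angularMean_axialVelocity)
open Summit.NavierStokesRegularity.NavierStokesRegularity.Theorems.HalfSpaceWindowDoorCirculationCarryingRigidityEddyTorqueStrata
  (rotGen_cylPt fderiv_swirl_e3 fderiv_swirl_eRang)

-- AxisTwistDoor's angular radial unit vector `e_r(θ)` is its `…Defs.eR`; renamed on opening to avoid the clash with the radial
-- unit vector FIELD `Literature.Analysis.FluidPDE.eR`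
open Summit.NavierStokesRegularity.NavierStokesRegularity.Theorems.AxisTwistDoorAveragedConeLiouvilleDefs renaming eR → eRang

variable {v : ℝ → EuclideanSpace ℝ (Fin 3) → EuclideanSpace ℝ (Fin 3)}

/-! ### The circle term is the circle-integrated advection of the angular-momentum density `g = r v_θ` -/

/-- **`T = ∮ (v·∇)(r v_θ) dθ`**: LRT's circle term `∮(v_r ω₃ − ω_r v₃) dl` equals `∫₀^{2π} D(x₀v₁ − x₁v₀)(y)[v(y)] dθ` along the
circle (the `e_θ`-component of the Lamb form `(v·∇)v = ω × v + ∇|v|²/2`, `D(r v_θ)(y)[w] = r⟪e_θ, Dv(y)w⟫ + ⟪J w, v⟫`, and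
`∮ ∂_θ|v|²/2 = 0`). -/
theorem circleTerm_eq_integral_fderiv_swirl {s : ℝ} (hv : ContDiff ℝ 1 (v s)) (r z : ℝ) :
    circleTerm v r z s = ∫ θ in (0 : ℝ)..(2 * Real.pi), fderiv ℝ (swirl (v s)) (cylPt r θ z) (v s (cylPt r θ z)) := by
  have hd : Differentiable ℝ (v s) := hv.differentiable one_ne_zero
  have hp := continuous_cylPt_θ r z
  have hvc : Continuous fun θ => v s (cylPt r θ z) := hv.continuous.comp hp
  have hDc : Continuous fun θ => fderiv ℝ (v s) (cylPt r θ z) := (hv.continuous_fderiv one_ne_zero).comp hp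
  -- pointwise: `D g[v] = (v_r ω₃ − ω_r v₃) r + ⟪Dv e_θ, v⟫ r`
  have hpt : ∀ θ : ℝ, fderiv ℝ (swirl (v s)) (cylPt r θ z) (v s (cylPt r θ z)) =
      (⟪v s (cylPt r θ z), eRang θ⟫_ℝ * ⟪curl (v s) (cylPt r θ z), e3⟫_ℝ
        - ⟪curl (v s) (cylPt r θ z), eRang θ⟫_ℝ * ⟪v s (cylPt r θ z), e3⟫_ℝ) * r
      + ⟪fderiv ℝ (v s) (cylPt r θ z) (eT θ), v s (cylPt r θ z)⟫_ℝ * r := by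
    intro θ
    rw [fderiv_swirl_apply (hd _), rotGen_cylPt, real_inner_smul_left, inner_rotGen_left,
      real_inner_comm (fderiv ℝ (v s) (cylPt r θ z) (v s (cylPt r θ z))) (eT θ), convective_pointwise]
    ring
  have hi1 : IntervalIntegrable (fun θ => (⟪v s (cylPt r θ z), eRang θ⟫_ℝ * ⟪curl (v s) (cylPt r θ z), e3⟫_ℝ
      - ⟪curl (v s) (cylPt r θ z), eRang θ⟫_ℝ * ⟪v s (cylPt r θ z), e3⟫_ℝ) * r) volume 0 (2 * Real.pi) := by
    have hωc : Continuous fun θ => curl (v s) (cylPt r θ z) := (continuous_curl hv).comp hp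
    exact ((((hvc.inner continuous_eR).mul (hωc.inner continuous_const)).sub
      ((hωc.inner continuous_eR).mul (hvc.inner continuous_const))).mul continuous_const).intervalIntegrable _ _
  have hi2 : IntervalIntegrable (fun θ => ⟪fderiv ℝ (v s) (cylPt r θ z) (eT θ), v s (cylPt r θ z)⟫_ℝ * r)
      volume 0 (2 * Real.pi) := ((hDc.clm_apply continuous_eT).inner hvc |>.mul continuous_const).intervalIntegrable _ _
  rw [intervalIntegral.integral_congr (fun θ _ => hpt θ), intervalIntegral.integral_add hi1 hi2,
    integral_kinetic_eq_zero hv r z, add_zero]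
  rfl

/-! ### The frame integrals of `D g` on a circle: `∮ Dg[e_r] = ∮ω₃ dl`, `∮ Dg[e_θ] = 0`, `∮ Dg[e₃] = −∮ω_r dl` -/

/-- `∮ D(r v_θ)[e_r(θ)] dθ = ∮ω₃ dl` (Stokes on circles: `∂ᵣ(r v_θ) = ω₃ r + ∂_θ v_r`). -/
theorem integral_fderiv_swirl_eRang {s : ℝ} (hv : ContDiff ℝ 1 (v s)) (r z : ℝ) :
    ∫ θ in (0 : ℝ)..(2 * Real.pi), fderiv ℝ (swirl (v s)) (cylPt r θ z) (eRang θ) = vortCirc v r z s := by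
  have hd : Differentiable ℝ (v s) := hv.differentiable one_ne_zero
  have hp := continuous_cylPt_θ r z
  have hpt : ∀ θ : ℝ, fderiv ℝ (swirl (v s)) (cylPt r θ z) (eRang θ) =
      ⟪curl (v s) (cylPt r θ z), e3⟫_ℝ * r
        + (⟪v s (cylPt r θ z), eT θ⟫_ℝ + ⟪fderiv ℝ (v s) (cylPt r θ z) (r • eT θ), eRang θ⟫_ℝ) := by
    intro θ; rw [fderiv_swirl_eRang hd, key_identity]
  have hi1 : IntervalIntegrable (fun θ => ⟪curl (v s) (cylPt r θ z), e3⟫_ℝ * r) volume 0 (2 * Real.pi) :=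
    ((((continuous_curl hv).comp hp).inner continuous_const).mul continuous_const).intervalIntegrable _ _
  rw [intervalIntegral.integral_congr (fun θ _ => hpt θ),
    intervalIntegral.integral_add hi1 ((continuous_radial_theta_deriv hv r z).intervalIntegrable _ _),
    integral_theta_deriv_eq_zero hv r z, add_zero]
  rfl

/-- `∮ D(r v_θ)[e₃] dθ = −∮ω_r dl` (`ω_r r = ∂_θ v₃ − ∂_z(r v_θ)` and `∮∂_θ v₃ = 0`). -/
theorem integral_fderiv_swirl_e3 {s : ℝ} (hv : ContDiff ℝ 1 (v s)) (r z : ℝ) :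
    ∫ θ in (0 : ℝ)..(2 * Real.pi), fderiv ℝ (swirl (v s)) (cylPt r θ z) e3 = -radVortCirc v r z s := by
  have hd : Differentiable ℝ (v s) := hv.differentiable one_ne_zero
  have hp := continuous_cylPt_θ r z
  have hpt : ∀ θ : ℝ, fderiv ℝ (swirl (v s)) (cylPt r θ z) e3 =
      fderiv ℝ (v s) (cylPt r θ z) (r • eT θ) 2 - ⟪curl (v s) (cylPt r θ z), eRang θ⟫_ℝ * r := by
    intro θ; rw [fderiv_swirl_e3 hd, inner_curl_eR_mul]; ring
  have hDc : Continuous fun θ => fderiv ℝ (v s) (cylPt r θ z) := (hv.continuous_fderiv one_ne_zero).comp hp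
  have hi1 : IntervalIntegrable (fun θ => fderiv ℝ (v s) (cylPt r θ z) (r • eT θ) 2) volume 0 (2 * Real.pi) :=
    ((EuclideanSpace.proj (2 : Fin 3) : EuclideanSpace ℝ (Fin 3) →L[ℝ] ℝ).continuous.comp
      (hDc.clm_apply (continuous_eT.const_smul r))).intervalIntegrable _ _
  have hi2 : IntervalIntegrable (fun θ => ⟪curl (v s) (cylPt r θ z), eRang θ⟫_ℝ * r) volume 0 (2 * Real.pi) :=
    ((((continuous_curl hv).comp hp).inner continuous_eR).mul continuous_const).intervalIntegrable _ _
  rw [intervalIntegral.integral_congr (fun θ _ => hpt θ), intervalIntegral.integral_sub hi1 hi2,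
    integral_fderiv_tangent_apply_two hv r z, zero_sub]
  rfl

/-- `∮ D(r v_θ)[r e_θ(θ)] dθ = 0` (`= ∮ ∂_θ (r v_θ)`, periodicity). -/
theorem integral_fderiv_swirl_smul_eT {s : ℝ} (hv : ContDiff ℝ 1 (v s)) (r z : ℝ) :
    ∫ θ in (0 : ℝ)..(2 * Real.pi), fderiv ℝ (swirl (v s)) (cylPt r θ z) (r • eT θ) = 0 := by
  have hd : Differentiable ℝ (v s) := hv.differentiable one_ne_zero
  have hdS : Differentiable ℝ (swirl (v s)) := fun x => differentiableAt_swirl (hd x)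
  have hS1 : ContDiff ℝ 1 (swirl (v s)) := contDiff_swirl hv
  have hderiv : ∀ θ : ℝ, HasDerivAt (fun θ' => swirl (v s) (cylPt r θ' z))
      (fderiv ℝ (swirl (v s)) (cylPt r θ z) (r • eT θ)) θ :=
    fun θ => (hdS _).hasFDerivAt.comp_hasDerivAt θ (hasDerivAt_cylPt_theta r θ z)
  have hc : Continuous fun θ => fderiv ℝ (swirl (v s)) (cylPt r θ z) (r • eT θ) :=
    ((hS1.continuous_fderiv one_ne_zero).comp (continuous_cylPt_θ r z)).clm_apply (continuous_eT.const_smul r)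
  rw [intervalIntegral.integral_eq_sub_of_hasDerivAt (fun θ _ => hderiv θ) (hc.intervalIntegrable _ _), cylPt_two_pi, sub_self]

/-! ### The angular-mean drift on a circle, in the frame -/

/-- Frame expansion of a vector: `w = ⟪w,e_r(θ)⟫ e_r(θ) + ⟪w,e_θ(θ)⟫ e_θ(θ) + ⟪w,e₃⟫ e₃`. -/
theorem frame_expansion (w : EuclideanSpace ℝ (Fin 3)) (θ : ℝ) :
    w = ⟪w, eRang θ⟫_ℝ • eRang θ + ⟪w, eT θ⟫_ℝ • eT θ + ⟪w, e3⟫_ℝ • e3 := by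
  have h := Real.sin_sq_add_cos_sq θ
  rw [inner_eR, inner_eT, inner_e3]
  ext i
  fin_cases i <;> simp [AxisTwistDoorAveragedConeLiouvilleDefs.eR, eT, e3]
  · linear_combination (-(w 0)) * h
  · linear_combination (-(w 1)) * h

/-- The azimuthal unit vector FIELD at a circle point off the axis: `e_θ(cylPt r θ z) = (−sin θ, cos θ, 0)` for `r > 0`. -/
theorem eTheta_cylPt {r : ℝ} (hr : 0 < r) (θ z : ℝ) : eTheta (cylPt r θ z) = eT θ := by
  have hc := cylRadius_cylPt hr.le θ z
  rw [eTheta, hc]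
  ext i
  fin_cases i <;> simp [cylPt, eT] <;> field_simp

/-- **`∮ D(r v_θ)[⟨v⟩_θ] dθ = v̄_r ∮ω₃ dl − v̄_z ∮ω_r dl`**: the angular-mean drift advects the angular-momentum density exactly by
the mean terms of the circle law (frame expansion of `⟨v⟩_θ` on the circle: components `v̄_r`, an angle-independent `⟨v_θ⟩_θ`,
`v̄_z`; then the three frame integrals). -/
theorem integral_fderiv_swirl_angularMeanVec {s : ℝ} (hv : ContDiff ℝ 1 (v s)) {r : ℝ} (hr : 0 < r) (z : ℝ) :
    ∫ θ in (0 : ℝ)..(2 * Real.pi), fderiv ℝ (swirl (v s)) (cylPt r θ z) (angularMeanVec (v s) (cylPt r θ z)) =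
      meanR v r z s * vortCirc v r z s - meanZ v r z s * radVortCirc v r z s := by
  have hd : Differentiable ℝ (v s) := hv.differentiable one_ne_zero
  have hvc : Continuous (v s) := hv.continuous
  have hS1 : ContDiff ℝ 1 (swirl (v s)) := contDiff_swirl hv
  have hcr : ∀ θ, cylRadius (cylPt r θ z) = r := fun θ => cylRadius_cylPt hr.le θ z
  have hz2 : ∀ θ, (cylPt r θ z) 2 = z := fun θ => by simp [cylPt]
  -- the three components of `⟨v⟩_θ` on the circle
  set cT : ℝ := angularMean (swirlVelocity (v s)) (cylPt r 0 z) with hcT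
  have hR : ∀ θ, ⟪angularMeanVec (v s) (cylPt r θ z), eRang θ⟫_ℝ = meanR v r z s := by
    intro θ
    rw [← eR_cylPt hr θ z, inner_angularMeanVec_eR hvc,
      angularMean_radialVelocity (v s) (by rw [hcr θ]; exact hr.ne') s v rfl, hcr θ, hz2 θ]
  have hT : ∀ θ, ⟪angularMeanVec (v s) (cylPt r θ z), eT θ⟫_ℝ = cT := by
    intro θ
    rw [← eTheta_cylPt hr θ z, inner_angularMeanVec_eTheta hvc, hcT, ← zero_add θ, ← rotZ_cylPt θ r 0 z,
      isAxisymmetricScalar_angularMean _ θ]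
  have hZ : ∀ θ, ⟪angularMeanVec (v s) (cylPt r θ z), e3⟫_ℝ = meanZ v r z s := by
    intro θ
    rw [inner_e3, angularMeanVec_apply_two hvc, angularMean_axialVelocity v s, hcr θ, hz2 θ]
  -- frame expansion under `Dg`
  have hpt : ∀ θ, fderiv ℝ (swirl (v s)) (cylPt r θ z) (angularMeanVec (v s) (cylPt r θ z)) =
      meanR v r z s * fderiv ℝ (swirl (v s)) (cylPt r θ z) (eRang θ)
        + cT * r⁻¹ * fderiv ℝ (swirl (v s)) (cylPt r θ z) (r • eT θ)
        + meanZ v r z s * fderiv ℝ (swirl (v s)) (cylPt r θ z) e3 := by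
    intro θ
    conv_lhs => rw [frame_expansion (angularMeanVec (v s) (cylPt r θ z)) θ]
    rw [hR, hT, hZ, map_add, map_add, map_smul, map_smul, map_smul, map_smul, smul_eq_mul, smul_eq_mul, smul_eq_mul,
      smul_eq_mul]
    field_simp
  have hp := continuous_cylPt_θ r z
  have hDS : Continuous fun θ => fderiv ℝ (swirl (v s)) (cylPt r θ z) := (hS1.continuous_fderiv one_ne_zero).comp hp
  have i1 : IntervalIntegrable (fun θ => meanR v r z s * fderiv ℝ (swirl (v s)) (cylPt r θ z) (eRang θ)) volume 0
      (2 * Real.pi) := (continuous_const.mul (hDS.clm_apply continuous_eR)).intervalIntegrable _ _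
  have i2 : IntervalIntegrable (fun θ => cT * r⁻¹ * fderiv ℝ (swirl (v s)) (cylPt r θ z) (r • eT θ)) volume 0
      (2 * Real.pi) := (continuous_const.mul (hDS.clm_apply (continuous_eT.const_smul r))).intervalIntegrable _ _
  have i3 : IntervalIntegrable (fun θ => meanZ v r z s * fderiv ℝ (swirl (v s)) (cylPt r θ z) e3) volume 0
      (2 * Real.pi) := (continuous_const.mul (hDS.clm_apply continuous_const)).intervalIntegrable _ _
  rw [intervalIntegral.integral_congr (fun θ _ => hpt θ), intervalIntegral.integral_add (i1.add i2) i3,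
    intervalIntegral.integral_add i1 i2, intervalIntegral.integral_const_mul, intervalIntegral.integral_const_mul,
    intervalIntegral.integral_const_mul, integral_fderiv_swirl_eRang hv, integral_fderiv_swirl_smul_eT hv,
    integral_fderiv_swirl_e3 hv]
  ring

/-! ### The remainder is the eddy advection of angular momentum -/

/-- **`ℛ = −∮ (v'·∇)(r v_θ) dθ`.**  The fluctuation remainder of AxisTwistDoor's circle-averaged swirl law equals minus the
circle integral of the derivative of the angular-momentum density `x₀v₁ − x₁v₀ = r v_θ` along the velocity FLUCTUATION
`v' = v − ⟨v⟩_θ` (Pineau–Vicol `angularFluctVec`): the EDDY TORQUE on the axis circle.  (Since `div v' = 0` and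
`∮(v'·∇)⟨r v_θ⟩_θ dθ = 0`, this is also `−[(1/r)∂ᵣ(r² ∮v'_r v'_θ dθ) + ∂_z(r ∮v'_z v'_θ dθ)]`, the divergence of the eddy
angular-momentum flux of the non-axisymmetric modes.) -/
theorem remainder_eq_neg_integral_fderiv_swirl_angularFluctVec {s : ℝ} (hv : ContDiff ℝ 1 (v s)) {r : ℝ} (hr : 0 < r)
    (z : ℝ) :
    remainder v r z s =
      -∫ θ in (0 : ℝ)..(2 * Real.pi), fderiv ℝ (swirl (v s)) (cylPt r θ z) (angularFluctVec (v s) (cylPt r θ z)) := by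
  have hS1 : ContDiff ℝ 1 (swirl (v s)) := contDiff_swirl hv
  have hp := continuous_cylPt_θ r z
  have hDS : Continuous fun θ => fderiv ℝ (swirl (v s)) (cylPt r θ z) := (hS1.continuous_fderiv one_ne_zero).comp hp
  have hpt : ∀ θ, fderiv ℝ (swirl (v s)) (cylPt r θ z) (angularFluctVec (v s) (cylPt r θ z)) =
      fderiv ℝ (swirl (v s)) (cylPt r θ z) (v s (cylPt r θ z))
        - fderiv ℝ (swirl (v s)) (cylPt r θ z) (angularMeanVec (v s) (cylPt r θ z)) := by
    intro θ; rw [angularFluctVec_apply, map_sub]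
  have i1 : IntervalIntegrable (fun θ => fderiv ℝ (swirl (v s)) (cylPt r θ z) (v s (cylPt r θ z))) volume 0
      (2 * Real.pi) := (hDS.clm_apply (hv.continuous.comp hp)).intervalIntegrable _ _
  have i2 : IntervalIntegrable (fun θ => fderiv ℝ (swirl (v s)) (cylPt r θ z) (angularMeanVec (v s) (cylPt r θ z)))
      volume 0 (2 * Real.pi) :=
    (hDS.clm_apply ((continuous_angularMeanVec hv.continuous).comp hp)).intervalIntegrable _ _
  rw [intervalIntegral.integral_congr (fun θ _ => hpt θ), intervalIntegral.integral_sub i1 i2,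
    ← circleTerm_eq_integral_fderiv_swirl hv, integral_fderiv_swirl_angularMeanVec hv hr, circleTerm_eq v hv r z]
  ring

end Summit.NavierStokesRegularity.NavierStokesRegularity.Theorems.HalfSpaceWindowDoorCirculationCarryingRigidityEddyTorqueIdentity

end
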